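import Summits.AtomisticToContinuum.Crystallization.Theorems.ChargedEnergyGapChartDialO
import Literature.Geometry.DiscreteGeometry.ShellCensusFrame

/-!
# `ChargedEnergyGap` · the CHART DIAL, part P: THE FINITE SHAPE STATEMENT IN CENSUS VOCABULARY, SCALES ELIMINATED
(decomp-a2c lens-3 g39 node «ChargeFreeGap», bridge beneath hypothesis 3)

Part O reduced hypothesis 3 of the line of record, `ChargeFreeShaped (3/20)`, to the closed finite-dimensional
statement `TwelveShellShaped (3/20)` about local dozens.  The tree already holds a certified census REPLAYER for
twelve-point shells (`Literature/Geometry/DiscreteGeometry/ShellCensusFrame.lean` ff.), whose metric conclusion is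
**tuple closeness** `ShellCensus.TupleClose η t p := ∃ (A : E3 →ₗᵢ[ℝ] E3) (σ : Equiv.Perm (Fin n)), ∀ k,
dist (t k) (A (p (σ k))) ≤ η` to a pattern TUPLE `p`.  This part proves that `TwelveShellShaped θ` IS the census-shaped
statement "every local dozen is `θ`-tuple-close to a cuboctahedral or to an anticuboctahedral tuple", for ANY pair of
tuples enumerating the two kissing patterns (e.g. the tree's `ShellCensus.fccTuple` / `hcpTuple`, by
`image_fccTuple` / `image_hcpTuple` of `ShellCensusTwelve.lean`, not imported here to keep the import light):

* `exists_equiv_of_perm` / `exists_perm_of_equiv` — the dictionary between a relabelling `σ : Equiv.Perm (Fin 12)` of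
  a pattern tuple and a bijective labelling `Fin 12 ≃ ↥(P.image A)` of the rotated pattern;
* **`twelveShellShaped_iff_tupleClose`** — `TwelveShellShaped θ ↔ ∀ t ρ, IsLocalDozen t ρ → TupleClose θ t pf ∨
  TupleClose θ t ph` whenever `univ.image pf = fccKissingPattern` and `univ.image ph = hcpKissingPattern`;
* the line of record on the census-shaped statement: `chartedChargePricing_of_far_cleanApproachHarnack_census`
  (`θ ≤ 3/20`).

§3–§4 then ELIMINATE THE SCALES, EXACTLY, for a certificate (or a census) that works on the twelve positions alone
with the bond relation as a finite case variable.  With `b i j :=` "frame-bond", a local dozen satisfies the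
POSITIONS-ONLY list (R1) radii `1 ≤ ‖t i‖ ≤ 101/100`; (R2) separation `‖t i‖ ≤ (101/100)·dist (t i) (t j)` (`i ≠ j`);
(R3) `b` symmetric, irreflexive, exactly four bonds at every vertex; (R4) `b i j → dist (t i) (t j) ≤ (101/100)·‖t i‖`
and `dist (t i) (t j) ≤ (101/100)·dist (t i) (t k)` for all `k ≠ i` (a bond is at most `1 %` longer than any other
distance at either endpoint); (R5) `i ≠ j → ¬ b i j →` at one endpoint the pair is longer than the radius AND than
every bond there — `IsLocalDozen.scaleFree`; and CONVERSELY every `(t, b)` satisfying (R1)–(R5) comes from a local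
dozen with frame-bond relation `b` (`exists_isLocalDozen_of_scaleFree`, scales `(100/101)·max (‖t i‖, longest bond
at i)`).  Hence **`twelveShellShaped_iff_scaleFree`**: `TwelveShellShaped θ ↔` every `(t, b)` with (R1)–(R5) is
`θ`-tuple-close to `pf` or `ph`; the certificate direction `twelveShellShaped_of_scaleFree` and the line
`chartedChargePricing_of_far_cleanApproachHarnack_scaleFree` (`θ ≤ 3/20`).

So a certificate in the replayer's format whose claim is tuple closeness at `η = 3/20` for the local-dozen constraint
list, or equivalently for the positions-only list (R1)–(R5) with `b` enumerated over the `4`-regular relations on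
twelve labels (NO far-pair gap in either), closes hypothesis 3 by name.  No `sorry`, no new axiom, no new definition,
no instance / notation / option.
-/

noncomputable section

open Literature.MathematicalPhysics.StatisticalMechanics
open Literature.Geometry.DiscreteGeometry
open Literature.Geometry.DiscreteGeometry.ShellCensus
open Summit.AtomisticToContinuum.Crystallization.Theses.PricedLinkCensus
open Summit.AtomisticToContinuum.Crystallization.Theorems.ChargedEnergyGapNegative

namespace Summit.AtomisticToContinuum.Crystallization.Theorems.ChargedEnergyGapChartDial

/-! ## §1 Relabellings versus bijective labellings -/

/-- A tuple enumerating a twelve-point set is injective. -/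
theorem injective_of_image_eq {P : Finset E3} {p : Fin 12 → E3} (hp : Finset.univ.image p = P)
    (hP : P.card = 12) : Function.Injective p := by
  have h : (Finset.univ.image p).card = (Finset.univ : Finset (Fin 12)).card := by
    rw [hp, hP, Finset.card_univ, Fintype.card_fin]
  have hon := Finset.injOn_of_card_image_eq h
  intro a b hab
  exact hon (by simp) (by simp) hab

/-- From a relabelling of a pattern tuple to a bijective labelling of the rotated pattern. -/
theorem exists_equiv_of_perm {P : Finset E3} {p : Fin 12 → E3} (hp : Finset.univ.image p = P) (hP : P.card = 12)
    (A : E3 →ₗᵢ[ℝ] E3) (σ : Equiv.Perm (Fin 12)) :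
    ∃ e : Fin 12 ≃ ↥(P.image A), ∀ k, (e k : E3) = A (p (σ k)) := by
  classical
  have hinj := injective_of_image_eq hp hP
  have hmem : ∀ k, A (p (σ k)) ∈ P.image A := fun k =>
    Finset.mem_image_of_mem _ (hp ▸ Finset.mem_image_of_mem p (Finset.mem_univ _))
  let f : Fin 12 → ↥(P.image A) := fun k => ⟨A (p (σ k)), hmem k⟩
  have hf : Function.Injective f := fun a b hab =>
    σ.injective (hinj (A.injective (congrArg Subtype.val hab)))
  have hcard : Fintype.card (Fin 12) = Fintype.card ↥(P.image A) := by
    rw [Fintype.card_coe, Finset.card_image_of_injective _ A.injective, hP, Fintype.card_fin]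
  have hbij : Function.Bijective f := (Fintype.bijective_iff_injective_and_card f).2 ⟨hf, hcard⟩
  exact ⟨Equiv.ofBijective f hbij, fun k => rfl⟩

/-- From a bijective labelling of the rotated pattern to a relabelling of a pattern tuple. -/
theorem exists_perm_of_equiv {P : Finset E3} {p : Fin 12 → E3} (hp : Finset.univ.image p = P)
    (A : E3 →ₗᵢ[ℝ] E3) (e : Fin 12 ≃ ↥(P.image A)) :
    ∃ σ : Equiv.Perm (Fin 12), ∀ k, A (p (σ k)) = (e k : E3) := by
  classical
  have hex : ∀ k, ∃ j, A (p j) = (e k : E3) := fun k => by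
    obtain ⟨y, hy, hye⟩ := Finset.mem_image.1 (e k).2
    rw [← hp] at hy
    obtain ⟨j, -, hj⟩ := Finset.mem_image.1 hy
    exact ⟨j, by rw [hj, hye]⟩
  choose g hg using hex
  have hginj : Function.Injective g := fun a b hab => by
    have h : (e a : E3) = (e b : E3) := by rw [← hg a, ← hg b, hab]
    exact e.injective (Subtype.ext h)
  have hgbij : Function.Bijective g := Finite.injective_iff_bijective.1 hginj
  exact ⟨Equiv.ofBijective g hgbij, fun k => hg k⟩

/-! ## §2 `TwelveShellShaped` in census vocabulary -/

/-- Tuple closeness to a pattern tuple gives a labelled chart of the rotated pattern. -/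
theorem exists_chart_of_tupleClose {θ : ℝ} {P : Finset E3} {p : Fin 12 → E3} (hp : Finset.univ.image p = P)
    (hP : P.card = 12) {t : Fin 12 → E3} (h : TupleClose θ t p) :
    ∃ (A : E3 →ₗᵢ[ℝ] E3) (e : Fin 12 ≃ ↥(P.image A)), ∀ i, dist (t i) (e i : E3) ≤ θ := by
  obtain ⟨A, σ, hσ⟩ := h
  obtain ⟨e, he⟩ := exists_equiv_of_perm hp hP A σ
  exact ⟨A, e, fun i => by rw [he i]; exact hσ i⟩

/-- A labelled chart of the rotated pattern gives tuple closeness to any tuple enumerating the pattern. -/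
theorem tupleClose_of_chart {θ : ℝ} {P : Finset E3} {p : Fin 12 → E3} (hp : Finset.univ.image p = P)
    {t : Fin 12 → E3} {A : E3 →ₗᵢ[ℝ] E3} (e : Fin 12 ≃ ↥(P.image A)) (he : ∀ i, dist (t i) (e i : E3) ≤ θ) :
    TupleClose θ t p := by
  obtain ⟨σ, hσ⟩ := exists_perm_of_equiv hp A e
  exact ⟨A, σ, fun k => by rw [hσ k]; exact he k⟩

/-- **Census form ⇒ `TwelveShellShaped`.** -/
theorem twelveShellShaped_of_tupleClose {θ : ℝ} {pf ph : Fin 12 → E3}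
    (hpf : Finset.univ.image pf = fccKissingPattern) (hph : Finset.univ.image ph = hcpKissingPattern)
    (h : ∀ (t : Fin 12 → E3) (ρ : Fin 12 → ℝ), IsLocalDozen t ρ → TupleClose θ t pf ∨ TupleClose θ t ph) :
    TwelveShellShaped θ := by
  intro t ρ hD
  rcases h t ρ hD with hf | hh
  · obtain ⟨A, e, he⟩ := exists_chart_of_tupleClose hpf card_fccKissingPattern hf
    exact ⟨fccKissingPattern, Or.inl rfl, A, e, he⟩
  · obtain ⟨A, e, he⟩ := exists_chart_of_tupleClose hph card_hcpKissingPattern hh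
    exact ⟨hcpKissingPattern, Or.inr rfl, A, e, he⟩

/-- **`TwelveShellShaped` ⇒ census form.** -/
theorem tupleClose_of_twelveShellShaped {θ : ℝ} (hS : TwelveShellShaped θ) {pf ph : Fin 12 → E3}
    (hpf : Finset.univ.image pf = fccKissingPattern) (hph : Finset.univ.image ph = hcpKissingPattern)
    {t : Fin 12 → E3} {ρ : Fin 12 → ℝ} (hD : IsLocalDozen t ρ) : TupleClose θ t pf ∨ TupleClose θ t ph := by
  obtain ⟨P, hP, A, e, he⟩ := hS t ρ hD
  rcases hP with rfl | rfl
  · exact Or.inl (tupleClose_of_chart hpf e he)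
  · exact Or.inr (tupleClose_of_chart hph e he)

/-- **The finite shape statement in census vocabulary**: for any tuples `pf`, `ph` enumerating the two kissing
patterns, `TwelveShellShaped θ` says exactly that every local dozen is `θ`-tuple-close to `pf` or to `ph`. -/
theorem twelveShellShaped_iff_tupleClose {θ : ℝ} {pf ph : Fin 12 → E3}
    (hpf : Finset.univ.image pf = fccKissingPattern) (hph : Finset.univ.image ph = hcpKissingPattern) :
    TwelveShellShaped θ ↔
      ∀ (t : Fin 12 → E3) (ρ : Fin 12 → ℝ), IsLocalDozen t ρ → TupleClose θ t pf ∨ TupleClose θ t ph :=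
  ⟨fun hS _ _ hD => tupleClose_of_twelveShellShaped hS hpf hph hD, twelveShellShaped_of_tupleClose hpf hph⟩

/-- **The line of record on the census-shaped statement** (`θ ≤ 3/20`): far-field pricing, clean-approach Harnack
and a tuple-closeness census of local dozens give `ChartedChargePricing θ`. -/
theorem chartedChargePricing_of_far_cleanApproachHarnack_census {θ R M₀ M₁ : ℝ} (hθ : θ ≤ 3 / 20) (hR : 0 < R)
    (hM₀ : 0 ≤ M₀) (hF : FarFieldPricing θ R) (hH : CleanApproachHarnack θ R M₀ M₁) {pf ph : Fin 12 → E3}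
    (hpf : Finset.univ.image pf = fccKissingPattern) (hph : Finset.univ.image ph = hcpKissingPattern)
    (hC : ∀ (t : Fin 12 → E3) (ρ : Fin 12 → ℝ), IsLocalDozen t ρ → TupleClose θ t pf ∨ TupleClose θ t ph) :
    ChartedChargePricing θ :=
  chartedChargePricing_of_far_cleanApproachHarnack_twelve hθ hR hM₀ hF hH (twelveShellShaped_of_tupleClose hpf hph hC)

/-! ## §3 Scale elimination: the positions-only form of a local dozen -/

section scaleFree

variable {t : Fin 12 → E3} {ρ : Fin 12 → ℝ}

/-- (R1) radii. -/
theorem IsLocalDozen.radii (h : IsLocalDozen t ρ) (i : Fin 12) : 1 ≤ ‖t i‖ ∧ ‖t i‖ ≤ 101 / 100 :=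
  ⟨(h.1 i).1, (h.1 i).2.1⟩

/-- The scale of a vertex is positive. -/
theorem IsLocalDozen.scale_pos (h : IsLocalDozen t ρ) (i : Fin 12) : 0 < ρ i := by
  have h1 := (h.1 i).1; have h4 := (h.1 i).2.2.2; nlinarith

/-- (R2) separation, scale-free form. -/
theorem IsLocalDozen.sep (h : IsLocalDozen t ρ) {i j : Fin 12} (hij : i ≠ j) :
    ‖t i‖ ≤ 101 / 100 * dist (t i) (t j) := by
  have h4 := (h.1 i).2.2.2; have hs := h.2.1 i j hij; nlinarith

/-- (R4a) a frame-bond is at most `1 %` longer than the radius of its endpoint. -/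
theorem IsLocalDozen.bond_le_norm (h : IsLocalDozen t ρ) {i j : Fin 12}
    (hb : dist (t i) (t j) ≤ (1 + 1 / 100) * ρ i) : dist (t i) (t j) ≤ 101 / 100 * ‖t i‖ := by
  have h3 := (h.1 i).2.2.1; nlinarith

/-- (R4b) a frame-bond is at most `1 %` longer than any other distance at its endpoint. -/
theorem IsLocalDozen.bond_le_dist (h : IsLocalDozen t ρ) {i j k : Fin 12}
    (hb : dist (t i) (t j) ≤ (1 + 1 / 100) * ρ i) (hk : k ≠ i) :
    dist (t i) (t j) ≤ 101 / 100 * dist (t i) (t k) := by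
  have hs := h.2.1 i k (Ne.symm hk); nlinarith

/-- (R5) a non-bond fails at one end, where it is longer than the radius and than every frame-bond. -/
theorem IsLocalDozen.nonbond (h : IsLocalDozen t ρ) {i j : Fin 12}
    (hb : ¬ (dist (t i) (t j) ≤ (1 + 1 / 100) * ρ i ∧ dist (t i) (t j) ≤ (1 + 1 / 100) * ρ j)) :
    (‖t i‖ < dist (t i) (t j) ∧ ∀ k, dist (t i) (t k) ≤ (1 + 1 / 100) * ρ i → dist (t i) (t k) < dist (t i) (t j)) ∨
    (‖t j‖ < dist (t i) (t j) ∧ ∀ k, dist (t j) (t k) ≤ (1 + 1 / 100) * ρ j → dist (t j) (t k) < dist (t i) (t j)) := by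
  have hi := (h.1 i).2.2.2; have hj := (h.1 j).2.2.2
  by_cases h1 : dist (t i) (t j) ≤ (1 + 1 / 100) * ρ i
  · have h2 := lt_of_not_ge fun h2 => hb ⟨h1, h2⟩
    exact Or.inr ⟨by linarith, fun k hk => by linarith⟩
  · have h2 := lt_of_not_ge h1
    exact Or.inl ⟨by linarith, fun k hk => by linarith⟩

/-- **Soundness of scale elimination**: the frame-bond relation of a local dozen satisfies the positions-only list
(R1)–(R5). -/
theorem IsLocalDozen.scaleFree (h : IsLocalDozen t ρ) :
    let b : Fin 12 → Fin 12 → Prop := fun i j =>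
      j ≠ i ∧ dist (t i) (t j) ≤ (1 + 1 / 100) * ρ i ∧ dist (t i) (t j) ≤ (1 + 1 / 100) * ρ j
    (∀ i, 1 ≤ ‖t i‖ ∧ ‖t i‖ ≤ 101 / 100) ∧
    (∀ i j, i ≠ j → ‖t i‖ ≤ 101 / 100 * dist (t i) (t j)) ∧
    (∀ i j, b i j → b j i) ∧ (∀ i, ¬ b i i) ∧ (∀ i, {j : Fin 12 | b i j}.ncard = 4) ∧
    (∀ i j, b i j → dist (t i) (t j) ≤ 101 / 100 * ‖t i‖ ∧
      ∀ k, k ≠ i → dist (t i) (t j) ≤ 101 / 100 * dist (t i) (t k)) ∧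
    (∀ i j, i ≠ j → ¬ b i j →
      (‖t i‖ < dist (t i) (t j) ∧ ∀ k, b i k → dist (t i) (t k) < dist (t i) (t j)) ∨
      (‖t j‖ < dist (t i) (t j) ∧ ∀ k, b j k → dist (t j) (t k) < dist (t i) (t j))) := by
  refine ⟨h.radii, fun i j hij => h.sep hij, fun i j hb => ⟨Ne.symm hb.1, by rw [dist_comm]; exact hb.2.2,
    by rw [dist_comm]; exact hb.2.1⟩, fun i hb => hb.1 rfl, h.2.2,
    fun i j hb => ⟨h.bond_le_norm hb.2.1, fun k hk => h.bond_le_dist hb.2.1 hk⟩, fun i j hij hb => ?_⟩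
  rcases h.nonbond (fun h2 => hb ⟨Ne.symm hij, h2⟩) with ⟨h1, h2⟩ | ⟨h1, h2⟩
  · exact Or.inl ⟨h1, fun k hk => h2 k hk.2.1⟩
  · exact Or.inr ⟨h1, fun k hk => h2 k hk.2.1⟩

/-- **Exactness of scale elimination**: positions `t` and a relation `b` satisfying (R1)–(R5) come from a local
dozen whose frame-bond relation is `b` (scales `ρ i := (100/101)·max (‖t i‖, longest bond at i)`). -/
theorem exists_isLocalDozen_of_scaleFree (t : Fin 12 → E3) (b : Fin 12 → Fin 12 → Prop)
    (h1 : ∀ i, 1 ≤ ‖t i‖ ∧ ‖t i‖ ≤ 101 / 100) (h2 : ∀ i j, i ≠ j → ‖t i‖ ≤ 101 / 100 * dist (t i) (t j))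
    (hsy : ∀ i j, b i j → b j i) (hir : ∀ i, ¬ b i i) (h4 : ∀ i, {j : Fin 12 | b i j}.ncard = 4)
    (hbd : ∀ i j, b i j → dist (t i) (t j) ≤ 101 / 100 * ‖t i‖ ∧
      ∀ k, k ≠ i → dist (t i) (t j) ≤ 101 / 100 * dist (t i) (t k))
    (hnb : ∀ i j, i ≠ j → ¬ b i j →
      (‖t i‖ < dist (t i) (t j) ∧ ∀ k, b i k → dist (t i) (t k) < dist (t i) (t j)) ∨
      (‖t j‖ < dist (t i) (t j) ∧ ∀ k, b j k → dist (t j) (t k) < dist (t i) (t j))) :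
    ∃ ρ : Fin 12 → ℝ, IsLocalDozen t ρ ∧
      ∀ i j, b i j ↔ (j ≠ i ∧ dist (t i) (t j) ≤ (1 + 1 / 100) * ρ i ∧ dist (t i) (t j) ≤ (1 + 1 / 100) * ρ j) := by
  classical
  -- `M i` = the largest of `‖t i‖` and the bond lengths at `i`
  have key : ∀ i, ∃ m : ℝ, ‖t i‖ ≤ m ∧ (∀ j, b i j → dist (t i) (t j) ≤ m) ∧
      (m = ‖t i‖ ∨ ∃ k, b i k ∧ m = dist (t i) (t k)) := by
    intro i
    let v : Fin 12 → ℝ := fun j => if b i j then dist (t i) (t j) else ‖t i‖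
    have hne : (Finset.univ.image v).Nonempty := Finset.univ_nonempty.image _
    refine ⟨(Finset.univ.image v).max' hne, ?_, ?_, ?_⟩
    · exact Finset.le_max' _ _ (Finset.mem_image.2 ⟨i, Finset.mem_univ _, by simp [v, hir i]⟩)
    · exact fun j hb => Finset.le_max' _ _ (Finset.mem_image.2 ⟨j, Finset.mem_univ _, by simp [v, hb]⟩)
    · obtain ⟨j, -, hj⟩ := Finset.mem_image.1 (Finset.max'_mem _ hne)
      by_cases hb : b i j
      · have hj' : v j = dist (t i) (t j) := by simp [v, hb]
        exact Or.inr ⟨j, hb, hj.symm.trans hj'⟩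
      · have hj' : v j = ‖t i‖ := by simp [v, hb]
        exact Or.inl (hj.symm.trans hj')
  choose M hMn hMb hMcase using key
  obtain ⟨ρ, hρ⟩ : ∃ ρ : Fin 12 → ℝ, ∀ i, (1 + 1 / 100) * ρ i = M i := ⟨fun i => 100 / 101 * M i, fun i => by ring⟩
  -- a pair within both thresholds is a bond (by (R5))
  have hback : ∀ i j, j ≠ i → dist (t i) (t j) ≤ M i → dist (t i) (t j) ≤ M j → b i j := by
    intro i j hji hi hj
    by_contra hb
    rcases hnb i j (Ne.symm hji) hb with ⟨hn, hk⟩ | ⟨hn, hk⟩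
    · rcases hMcase i with hM | ⟨k, hbk, hM⟩
      · linarith
      · linarith [hk k hbk]
    · rcases hMcase j with hM | ⟨k, hbk, hM⟩
      · linarith
      · linarith [hk k hbk]
  have hiff : ∀ i j, b i j ↔ (j ≠ i ∧ dist (t i) (t j) ≤ (1 + 1 / 100) * ρ i ∧
      dist (t i) (t j) ≤ (1 + 1 / 100) * ρ j) := by
    intro i j
    rw [hρ i, hρ j]
    constructor
    · intro hb
      refine ⟨fun hji => hir i (hji ▸ hb), hMb i j hb, ?_⟩
      have := hMb j i (hsy i j hb); rwa [dist_comm] at this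
    · rintro ⟨hji, hi, hj⟩; exact hback i j hji hi hj
  refine ⟨ρ, ⟨fun i => ⟨(h1 i).1, (h1 i).2, ?_, by linarith [hMn i, hρ i]⟩, fun i j hij => ?_, fun i => ?_⟩, hiff⟩
  · -- `ρ i ≤ ‖t i‖`
    rcases hMcase i with hM | ⟨k, hk, hM⟩
    · linarith [(h1 i).1, hρ i]
    · linarith [(hbd i k hk).1, hρ i]
  · -- separation
    rcases hMcase i with hM | ⟨k, hk, hM⟩
    · linarith [h2 i j hij, hρ i]
    · linarith [(hbd i k hk).2 j (Ne.symm hij), hρ i]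
  · -- four frame-bonds
    have hset : {j : Fin 12 | j ≠ i ∧ dist (t i) (t j) ≤ (1 + 1 / 100) * ρ i ∧
        dist (t i) (t j) ≤ (1 + 1 / 100) * ρ j} = {j : Fin 12 | b i j} :=
      Set.ext fun j => (hiff i j).symm
    rw [hset]; exact h4 i

end scaleFree

/-! ## §4 The census on positions only -/

/-- **Positions-only census ⇔ `TwelveShellShaped`.**  `TwelveShellShaped θ` says exactly: every twelve positions `t`
and symmetric irreflexive relation `b` with four bonds per vertex satisfying (R1), (R2), (R4), (R5) are `θ`-tuple-close
to a cuboctahedral or an anticuboctahedral tuple. -/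
theorem twelveShellShaped_iff_scaleFree {θ : ℝ} {pf ph : Fin 12 → E3}
    (hpf : Finset.univ.image pf = fccKissingPattern) (hph : Finset.univ.image ph = hcpKissingPattern) :
    TwelveShellShaped θ ↔ ∀ (t : Fin 12 → E3) (b : Fin 12 → Fin 12 → Prop),
      (∀ i, 1 ≤ ‖t i‖ ∧ ‖t i‖ ≤ 101 / 100) →
      (∀ i j, i ≠ j → ‖t i‖ ≤ 101 / 100 * dist (t i) (t j)) →
      (∀ i j, b i j → b j i) → (∀ i, ¬ b i i) → (∀ i, {j : Fin 12 | b i j}.ncard = 4) →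
      (∀ i j, b i j → dist (t i) (t j) ≤ 101 / 100 * ‖t i‖ ∧
        ∀ k, k ≠ i → dist (t i) (t j) ≤ 101 / 100 * dist (t i) (t k)) →
      (∀ i j, i ≠ j → ¬ b i j →
        (‖t i‖ < dist (t i) (t j) ∧ ∀ k, b i k → dist (t i) (t k) < dist (t i) (t j)) ∨
        (‖t j‖ < dist (t i) (t j) ∧ ∀ k, b j k → dist (t j) (t k) < dist (t i) (t j))) →
      TupleClose θ t pf ∨ TupleClose θ t ph := by
  rw [twelveShellShaped_iff_tupleClose hpf hph]
  constructor
  · intro h t b h1 h2 hsy hir h4 hbd hnb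
    obtain ⟨ρ, hD, -⟩ := exists_isLocalDozen_of_scaleFree t b h1 h2 hsy hir h4 hbd hnb
    exact h t ρ hD
  · intro h t ρ hD
    obtain ⟨h1, h2, hsy, hir, h4, hbd, hnb⟩ := hD.scaleFree
    exact h t _ h1 h2 hsy hir h4 hbd hnb

/-- **Positions-only census ⇒ `TwelveShellShaped`** (the direction a certificate uses). -/
theorem twelveShellShaped_of_scaleFree {θ : ℝ} {pf ph : Fin 12 → E3}
    (hpf : Finset.univ.image pf = fccKissingPattern) (hph : Finset.univ.image ph = hcpKissingPattern)
    (h : ∀ (t : Fin 12 → E3) (b : Fin 12 → Fin 12 → Prop),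
      (∀ i, 1 ≤ ‖t i‖ ∧ ‖t i‖ ≤ 101 / 100) →
      (∀ i j, i ≠ j → ‖t i‖ ≤ 101 / 100 * dist (t i) (t j)) →
      (∀ i j, b i j → b j i) → (∀ i, ¬ b i i) → (∀ i, {j : Fin 12 | b i j}.ncard = 4) →
      (∀ i j, b i j → dist (t i) (t j) ≤ 101 / 100 * ‖t i‖ ∧
        ∀ k, k ≠ i → dist (t i) (t j) ≤ 101 / 100 * dist (t i) (t k)) →
      (∀ i j, i ≠ j → ¬ b i j →
        (‖t i‖ < dist (t i) (t j) ∧ ∀ k, b i k → dist (t i) (t k) < dist (t i) (t j)) ∨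
        (‖t j‖ < dist (t i) (t j) ∧ ∀ k, b j k → dist (t j) (t k) < dist (t i) (t j))) →
      TupleClose θ t pf ∨ TupleClose θ t ph) :
    TwelveShellShaped θ :=
  (twelveShellShaped_iff_scaleFree hpf hph).2 h

/-- **The line of record on the positions-only census** (`θ ≤ 3/20`). -/
theorem chartedChargePricing_of_far_cleanApproachHarnack_scaleFree {θ R M₀ M₁ : ℝ} (hθ : θ ≤ 3 / 20) (hR : 0 < R)
    (hM₀ : 0 ≤ M₀) (hF : FarFieldPricing θ R) (hH : CleanApproachHarnack θ R M₀ M₁) {pf ph : Fin 12 → E3}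
    (hpf : Finset.univ.image pf = fccKissingPattern) (hph : Finset.univ.image ph = hcpKissingPattern)
    (h : ∀ (t : Fin 12 → E3) (b : Fin 12 → Fin 12 → Prop),
      (∀ i, 1 ≤ ‖t i‖ ∧ ‖t i‖ ≤ 101 / 100) →
      (∀ i j, i ≠ j → ‖t i‖ ≤ 101 / 100 * dist (t i) (t j)) →
      (∀ i j, b i j → b j i) → (∀ i, ¬ b i i) → (∀ i, {j : Fin 12 | b i j}.ncard = 4) →
      (∀ i j, b i j → dist (t i) (t j) ≤ 101 / 100 * ‖t i‖ ∧
        ∀ k, k ≠ i → dist (t i) (t j) ≤ 101 / 100 * dist (t i) (t k)) →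
      (∀ i j, i ≠ j → ¬ b i j →
        (‖t i‖ < dist (t i) (t j) ∧ ∀ k, b i k → dist (t i) (t k) < dist (t i) (t j)) ∨
        (‖t j‖ < dist (t i) (t j) ∧ ∀ k, b j k → dist (t j) (t k) < dist (t i) (t j))) →
      TupleClose θ t pf ∨ TupleClose θ t ph) :
    ChartedChargePricing θ :=
  chartedChargePricing_of_far_cleanApproachHarnack_twelve hθ hR hM₀ hF hH (twelveShellShaped_of_scaleFree hpf hph h)

end Summit.AtomisticToContinuum.Crystallization.Theorems.ChargedEnergyGapChartDial

end
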